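import Summits.ValiantsHypothesis.ValiantsHypothesis.Theses.KPlusLogSqLaw
import Summits.ValiantsHypothesis.ValiantsHypothesis.Theorems.KPlusLogSqLawTropicalBRegimeCollapse
import Summits.ValiantsHypothesis.ValiantsHypothesis.Theorems.KPlusLogSqLawTropicalBTowerLogOfDoublingQuasi
import Summits.ValiantsHypothesis.ValiantsHypothesis.Theorems.KPlusLogSqLawTropicalBPolyTowers

/-!
# Crux `TropicalB` (stmt-ValiantsHypothesis-19771) — line «aspect-decay» (ideator val-idea-11 g5, lens `wuc`)

HONEST FRAMING.  A proof SKELETON over the OPEN crux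
`Summit.ValiantsHypothesis.ValiantsHypothesis.Theses.KPlusLogSqLaw.TropicalB` (= `…Theses.KPlusLogSqLawOctave.TropicalB`,
ledger item `stmt-ValiantsHypothesis-19771`, routes `KPlusLogSqLaw` (open) / `KPlusLogSqLawOctave` (draft)).  The two `stub_*`
theorems (and, rev 2, the committed instrument instance `stub_aspectDecayDoublingAt_two`) are `sorry` and are NOT claimed; every other theorem is sorry-free.  Nothing is asserted about `TropicalB`,
`WeakLifting`, `OctaveWeakLifting`, `MatrixDescartes` (stmt-18050) or VP ≠ VNP — **VP ≠ VNP is not moved by this file**.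

Write `T(m,K)` for the signed tropical capacity (least `B` with `TropRootLawAt m K B`).

THE LENS (weakest unknown consequence).  On the SIZE axis the weakest consequence of `TropicalB` that the tree does not decide is the
**bounded-aspect rate law** `BoundedAspectRate`: for every aspect ratio `A`, eventually in `K`, `T(A·K, K) ≤ 2^(C·K)` with ONE `C`.
(Per fixed `A` slope counting only gives `2^(K·log₂(2e(A+1)))`, i.e. a rate growing with `A`; the proved separated-lex sector has the
aspect-free rate `log₂ 5`, `…TropicalBSeparatedTower`.)  It sits below the registered plan-only foothold `stub_tropTowerLog`
(`T(K·log₂K, K) ≤ 2^(C·K)`, `boundedAspectRate_of_towerLog`) and below the square tower; `TropicalB` is exactly `BoundedAspectRate`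
with the ONSET `K₀(A) = (⌊log₂ A⌋+1)²` (`tropicalB_iff_expSqrtTower`, file `…TropicalBRegimeCollapse`).  Its negation kills the crux
(`not_tropicalB_of_not_boundedAspectRate`).  It is registered here as the line's RUNG (`stub_boundedAspectRate`): the `A`-th partial
product of the engine below proves it with that onset (`boundedAspectRate_of_aspectDecayDoubling`).

THE ENGINE (`stub_aspectDecayDoubling`, the one load-bearing stub).  ROW DOUBLING ON FAT FORMATS WITH A `K`-AWARE, LEVEL-SUMMABLE LOSS:
for dyadic aspects `2^a` with `a² ≤ K`,
  `T(2^(a+1)·K, K) + 1 ≤ 2^(c·(⌊K/2^a⌋ + ⌊√K⌋ + ⌊log₂K⌋ + 1)) · (T(2^a·K, K) + 1)`.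
The allowance `c·K/2^a` is GENEROUS in the fat corner (`a = O(1)`: a full `2^(cK)`), where the counting-tight jumps `(27/16)^K` of
`(K,K) → (2K,K)` live — the recorded risk of the registered `stub_signedDoubling` (`Lines/doubling.lean`: polynomial loss `(2m)^c` from
size `K` on) — and decays geometrically with the aspect; the uniform allowance `c(√K + log₂K + 1)` per level is affordable because only
the `⌊√K⌋` dyadic levels of the FAT regime are needed (`tropicalB_iff_expSqrtTower`): the exponents sum to `≤ (7c+6)·K`
(`Σ_{i<a} ⌊K/2^i⌋ ≤ 2K`, `a·√K ≤ K`, `a·log₂K ≤ 3K`).  Consequences proved below: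
* `TropicalB_of : AspectDecayDoubling → TropicalB` (the composition, kernel-checked; base `T(K,K) ≤ 2^(5K)` =
  `DoublingQuasi.tropRootLawAt_fatCone`, slope counting);
* `aspectDecayDoubling_of_signedDoubling`: the registered `stub_signedDoubling` IMPLIES the engine (on fat formats its loss
  `(2^(a+1)K)^c·2` is below ours since `a ≤ √K`), so the engine is a WEAKER sufficient law: it survives the `(10,5)`-vs-`(5,5)` /
  `(27/16)^K` kill that threatens `stub_signedDoubling`, and it needs no second open piece (contrast `Lines/square_doubling.lean`,
  which moves the threshold to `K²` and pays `stub_squareTower`);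
* `boundedAspectRate_of_aspectDecayDoubling`, `boundedAspectRate_of_tropicalB`, `boundedAspectRate_of_towerLog` (honesty: the rung
  is a CONSEQUENCE of the crux, of the engine, and of the TowerLog foothold; it is NOT load-bearing in `TropicalB_of`).
NOT implied by `TropicalB` as far as the tree knows (TB bounds each capacity, not one-step ratios); restricted to `a² ≤ K` because on
thin formats the kernel staircase (`…CensusTropicalKLawStaircase`, ratio `2^((K-2)/2)` per row doubling at `K ≤ log₂ m`) refutes any
`2^(O(√K))` one-step loss.  [folklore] arithmetic; the laws themselves are cell conjectures (no citation exists).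
-/

set_option linter.dupNamespace false
set_option autoImplicit false

namespace Summit.ValiantsHypothesis.ValiantsHypothesis.Cruxes.TropicalB.AspectDecay

open Summit.ValiantsHypothesis.ValiantsHypothesis.Theorems.LacunarySymmetroidMatrixDescartes.TropicalCensus
open Summit.ValiantsHypothesis.ValiantsHypothesis.Theses.KPlusLogSqLaw (TropicalB)
open Summit.ValiantsHypothesis.ValiantsHypothesis.Theorems.KPlusLogSqLaw

/-! ## 1. The two statements -/

/-- loss exponent of ONE row doubling at dyadic aspect `2^a` with `K` slope classes:
`c·(⌊K/2^a⌋ + ⌊√K⌋ + ⌊log₂ K⌋ + 1)` — generous (`≈ cK`) in the fat corner, decaying geometrically in the aspect. -/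
def lossExp (c a K : ℕ) : ℕ := c * (K / 2 ^ a + Nat.sqrt K + Nat.log 2 K + 1)

/-- **ENGINE — aspect-decay row doubling on fat formats.**  For dyadic aspects `2^a` with `a² ≤ K`:
`T(2^(a+1)·K, K) ≤ 2^(lossExp c a K) · (T(2^a·K, K) + 1)`. -/
def AspectDecayDoubling : Prop :=
  ∃ c : ℕ, ∀ a K B : ℕ, a ^ 2 ≤ K →
    TropRootLawAt (2 ^ a * K) K B → TropRootLawAt (2 ^ (a + 1) * K) K (2 ^ lossExp c a K * (B + 1))

/-- **RUNG (lens `wuc`) — the bounded-aspect rate law.**  One rate constant `C` serves every aspect ratio `A = m/K`,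
eventually in `K`: `∀ A, ∃ K₀, ∀ K ≥ K₀, T(A·K, K) ≤ 2^(C·K)`. -/
def BoundedAspectRate : Prop :=
  ∃ C : ℕ, ∀ A : ℕ, ∃ K₀ : ℕ, ∀ K : ℕ, K₀ ≤ K → TropRootLawAt (A * K) K (2 ^ (C * K))

/-! ## 2. The stubs (the ONLY sorries of this file; not claimed) -/

/-- ENGINE stub (load-bearing in `TropicalB_of`).  Why it might fail: a single fat-regime row doubling at aspect `2^a`,
`log₂K ≪ a ≤ √K`, gaining more than `c(√K + log₂K + 1)` bits for every `c` (an irregular jump compatible with `TropicalB`). -/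
theorem stub_aspectDecayDoubling : AspectDecayDoubling := by
  sorry

/-- RUNG stub (wuc; a consequence of the crux, `boundedAspectRate_of_tropicalB`).  Why it might fail: a family of bounded-aspect
formats `(A_j·K, K)`, `K → ∞`, with `T ≥ 2^(C_j·K)` and `C_j → ∞` — which refutes `TropicalB` (`not_tropicalB_of_not_boundedAspectRate`). -/
theorem stub_boundedAspectRate : BoundedAspectRate := by
  sorry

/-! ## 3. Arithmetic -/

/-- partial geometric sums `Σ_{j<i} ⌊K/2^j⌋`. -/
def geo (K : ℕ) : ℕ → ℕ
  | 0 => 0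
  | i + 1 => geo K i + K / 2 ^ i

theorem geo_succ (K i : ℕ) : geo K (i + 1) = geo K i + K / 2 ^ i := rfl

theorem geo_succ_add_le (K : ℕ) : ∀ i : ℕ, geo K (i + 1) + K / 2 ^ i ≤ 2 * K := by
  intro i
  induction i with
  | zero => simp [geo]; omega
  | succ i ih =>
    have h2 : 2 * (K / 2 ^ (i + 1)) ≤ K / 2 ^ i := by
      rw [pow_succ, ← Nat.div_div_eq_div_mul]
      exact Nat.mul_div_le (K / 2 ^ i) 2
    rw [geo_succ K (i + 1)]
    omega

theorem geo_le (K i : ℕ) : geo K i ≤ 2 * K := by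
  cases i with
  | zero => simp [geo]
  | succ i => exact le_trans (Nat.le_add_right _ _) (geo_succ_add_le K i)

theorem sq_le_two_mul_two_pow (n : ℕ) : n ^ 2 ≤ 2 * 2 ^ n := by
  induction n with
  | zero => norm_num
  | succ n ih =>
    have h := Nat.lt_two_pow_self (n := n)
    rw [pow_succ 2 n]
    nlinarith

/-- `⌊log₂ K⌋² ≤ 2K`. [folklore] -/
theorem log_sq_le_two_mul (K : ℕ) : Nat.log 2 K ^ 2 ≤ 2 * K := by
  rcases Nat.eq_zero_or_pos K with rfl | hK
  · simp
  · exact (sq_le_two_mul_two_pow _).trans (Nat.mul_le_mul_left 2 (Nat.pow_log_le_self 2 hK.ne'))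

/-- the exponent after `i` levels. -/
def levelExp (c K i : ℕ) : ℕ := 5 * K + c * geo K i + i * (c * (Nat.sqrt K + Nat.log 2 K + 1) + 1)

theorem levelExp_le {c K i : ℕ} (hi : i ^ 2 ≤ K) : levelExp c K i ≤ (7 * c + 6) * K := by
  have hi' : i ≤ Nat.sqrt K := Nat.le_sqrt'.mpr hi
  have hs : Nat.sqrt K ^ 2 ≤ K := Nat.sqrt_le' K
  have hsK : Nat.sqrt K ≤ K := Nat.sqrt_le_self K
  have hg : geo K i ≤ 2 * K := geo_le K i
  have hl : Nat.log 2 K ^ 2 ≤ 2 * K := log_sq_le_two_mul K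
  have h1 : i * Nat.sqrt K ≤ K := by nlinarith
  have h2 : i * Nat.log 2 K ≤ 3 * K := by nlinarith
  have h3 : i ≤ K := hi'.trans hsK
  unfold levelExp
  have h4 : c * geo K i ≤ c * (2 * K) := Nat.mul_le_mul_left c hg
  have h5 : i * (c * (Nat.sqrt K + Nat.log 2 K + 1) + 1)
      = c * (i * Nat.sqrt K) + c * (i * Nat.log 2 K) + c * i + i := by ring
  have h6 : c * (i * Nat.sqrt K) ≤ c * K := Nat.mul_le_mul_left c h1
  have h7 : c * (i * Nat.log 2 K) ≤ c * (3 * K) := Nat.mul_le_mul_left c h2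
  have h8 : c * i ≤ c * K := Nat.mul_le_mul_left c h3
  nlinarith

/-! ## 4. Iterating the engine along the `⌊√K⌋` dyadic levels of the fat regime -/

theorem iterate {c : ℕ}
    (hE : ∀ a K B : ℕ, a ^ 2 ≤ K →
      TropRootLawAt (2 ^ a * K) K B → TropRootLawAt (2 ^ (a + 1) * K) K (2 ^ lossExp c a K * (B + 1)))
    (K : ℕ) : ∀ i : ℕ, i ^ 2 ≤ K → TropRootLawAt (2 ^ i * K) K (2 ^ levelExp c K i) := by
  intro i
  induction i with
  | zero =>
    intro _
    have h0 : TropRootLawAt K K (2 ^ (5 * K)) := DoublingQuasi.tropRootLawAt_fatCone (by omega)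
    simpa [levelExp, geo] using h0
  | succ i ih =>
    intro hi
    have hi0 : i ^ 2 ≤ K := le_trans (Nat.pow_le_pow_left (Nat.le_succ i) 2) hi
    have h1 := hE i K _ hi0 (ih hi0)
    refine tropRootLawAt_mono ?_ h1
    have h2 : 2 ^ levelExp c K i + 1 ≤ 2 ^ (levelExp c K i + 1) := by
      have := Nat.one_le_two_pow (n := levelExp c K i)
      rw [pow_succ]; omega
    calc 2 ^ lossExp c i K * (2 ^ levelExp c K i + 1)
        ≤ 2 ^ lossExp c i K * 2 ^ (levelExp c K i + 1) := Nat.mul_le_mul_left _ h2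
      _ = 2 ^ (lossExp c i K + (levelExp c K i + 1)) := (pow_add 2 _ _).symm
      _ = 2 ^ levelExp c K (i + 1) := by
          congr 1
          simp only [lossExp, levelExp, geo_succ]
          ring

/-- all fat dyadic formats at ONE rate: `i² ≤ K → T(2^i·K, K) ≤ 2^((7c+6)·K)`. -/
theorem fat_dyadic_rate {c : ℕ}
    (hE : ∀ a K B : ℕ, a ^ 2 ≤ K →
      TropRootLawAt (2 ^ a * K) K B → TropRootLawAt (2 ^ (a + 1) * K) K (2 ^ lossExp c a K * (B + 1)))
    {K i : ℕ} (hi : i ^ 2 ≤ K) : TropRootLawAt (2 ^ i * K) K (2 ^ ((7 * c + 6) * K)) :=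
  tropRootLawAt_mono (Nat.pow_le_pow_right two_pos (levelExp_le hi)) (iterate hE K i hi)

/-! ## 5. The composition: the engine ALONE gives the crux -/

/-- **COMPOSITION (kernel-checked, sorry-free): `AspectDecayDoubling → TropicalB`**, via the exponential-sqrt tower
`tropicalB_iff_expSqrtTower` at level `i = ⌊√K⌋`. -/
theorem TropicalB_of (h : AspectDecayDoubling) : TropicalB := by
  obtain ⟨c, hE⟩ := h
  refine tropicalB_iff_expSqrtTower.mpr ⟨7 * c + 6, fun K => ?_⟩
  rcases Nat.eq_zero_or_pos K with rfl | hK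
  · exact tropRootLawAt_zero _ _
  have h1 : TropRootLawAt (2 ^ Nat.sqrt K * K) K (2 ^ ((7 * c + 6) * K)) := fat_dyadic_rate hE (Nat.sqrt_le' K)
  exact tropRootLawAt_of_le (Nat.le_mul_of_pos_right _ hK) le_rfl h1

/-- SKELETON THEOREM (the engine stub enters BY NAME; the unique theorem of this file concluding the crux from a `sorry`). -/
theorem TropicalB_skeleton_aspectDecay : TropicalB := TropicalB_of stub_aspectDecayDoubling

/-! ## 6. Honesty: where the rung sits -/

/-- the rung from the ENGINE, with the explicit onset `K₀(A) = (⌊log₂A⌋+1)²`. -/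
theorem boundedAspectRate_of_aspectDecayDoubling (h : AspectDecayDoubling) : BoundedAspectRate := by
  obtain ⟨c, hE⟩ := h
  refine ⟨7 * c + 6, fun A => ⟨(Nat.log 2 A + 1) ^ 2, fun K hK => ?_⟩⟩
  have h1 : TropRootLawAt (2 ^ (Nat.log 2 A + 1) * K) K (2 ^ ((7 * c + 6) * K)) := fat_dyadic_rate hE hK
  have hA : A ≤ 2 ^ (Nat.log 2 A + 1) := (Nat.lt_pow_succ_log_self one_lt_two A).le
  exact tropRootLawAt_of_le (Nat.mul_le_mul_right K hA) le_rfl h1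

/-- `⌊log₂(A·K)⌋² ≤ K` once `K ≥ 4^(max (⌊log₂A⌋+2) 8)`. [folklore] -/
theorem log_sq_mul_le {A K : ℕ} (hK : 4 ^ max (Nat.log 2 A + 2) 8 ≤ K) : Nat.log 2 (A * K) ^ 2 ≤ K := by
  have h0 := PolyTowers.sq_log_succ_le_self (Nat.log 2 A + 2) K hK
  have hlog : Nat.log 2 (A * K) ≤ Nat.log 2 A + Nat.log 2 K + 1 := by
    rcases Nat.eq_zero_or_pos (A * K) with hz | hpos
    · rw [hz, Nat.log_zero_right]; omega
    have hA : A < 2 ^ (Nat.log 2 A + 1) := Nat.lt_pow_succ_log_self one_lt_two A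
    have hK' : K < 2 ^ (Nat.log 2 K + 1) := Nat.lt_pow_succ_log_self one_lt_two K
    have hAK : A * K < 2 ^ (Nat.log 2 A + Nat.log 2 K + 2) := by
      calc A * K < 2 ^ (Nat.log 2 A + 1) * 2 ^ (Nat.log 2 K + 1) := Nat.mul_lt_mul'' hA hK'
        _ = 2 ^ (Nat.log 2 A + Nat.log 2 K + 2) := by rw [← pow_add]; ring_nf
    have := Nat.log_lt_of_lt_pow hpos.ne' hAK
    omega
  have h1 : Nat.log 2 A + Nat.log 2 K + 1 ≤ (Nat.log 2 A + 2) * (Nat.log 2 K + 1) := by nlinarith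
  calc Nat.log 2 (A * K) ^ 2 ≤ (Nat.log 2 A + Nat.log 2 K + 1) ^ 2 := Nat.pow_le_pow_left hlog 2
    _ ≤ ((Nat.log 2 A + 2) * (Nat.log 2 K + 1)) ^ 2 := Nat.pow_le_pow_left h1 2
    _ = (Nat.log 2 A + 2) ^ 2 * (Nat.log 2 K + 1) ^ 2 := by ring
    _ ≤ K := h0

/-- HONESTY: the rung is a CONSEQUENCE of the crux (via the fat stub `fatStub_of_tropicalB`), onset `4^(max (⌊log₂A⌋+2) 8)`. -/
theorem boundedAspectRate_of_tropicalB (h : TropicalB) : BoundedAspectRate := by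
  obtain ⟨C, hC⟩ := fatStub_of_tropicalB h
  exact ⟨C, fun A => ⟨4 ^ max (Nat.log 2 A + 2) 8, fun K hK => hC (A * K) K (log_sq_mul_le hK)⟩⟩

/-- KILL PATH: a refutation of the rung refutes the crux. -/
theorem not_tropicalB_of_not_boundedAspectRate (h : ¬ BoundedAspectRate) : ¬ TropicalB :=
  fun hT => h (boundedAspectRate_of_tropicalB hT)

/-- HONESTY: the rung sits below the registered plan-only foothold `stub_tropTowerLog` (`T(K·log₂K, K) ≤ 2^(C·K)`): onset `K₀ = 2^A`. -/
theorem boundedAspectRate_of_towerLog (h : ∃ C : ℕ, ∀ K : ℕ, TropRootLawAt (K * Nat.log 2 K) K (2 ^ (C * K))) :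
    BoundedAspectRate := by
  obtain ⟨C, hC⟩ := h
  refine ⟨C, fun A => ⟨2 ^ A, fun K hK => ?_⟩⟩
  have hA : A ≤ Nat.log 2 K := by
    have := Nat.log_mono_right (b := 2) hK
    rwa [Nat.log_pow one_lt_two] at this
  have h1 : A * K ≤ K * Nat.log 2 K := by rw [mul_comm]; exact Nat.mul_le_mul_left K hA
  exact tropRootLawAt_of_le h1 le_rfl (hC K)

/-- LATTICE: the registered `stub_signedDoubling` (`Lines/doubling.lean`, balanced signed doubling with polynomial loss from size `K` on)
IMPLIES the engine — on fat formats `a ≤ √K`, so `(2^(a+1)·K)^c · 2 ≤ 2^((2c+2)(⌊K/2^a⌋ + √K + log₂K + 1))`.  Hence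
`stub_signedDoubling ⟹ AspectDecayDoubling ⟹ TropicalB ⟹ BoundedAspectRate`. -/
theorem aspectDecayDoubling_of_signedDoubling
    (h : ∃ c : ℕ, ∀ (K a e B₁ B₂ : ℕ), K ≤ a → a ≤ e → e ≤ a + 1 → TropRootLawAt a K B₁ → TropRootLawAt e K B₂ →
      TropRootLawAt (a + e) K ((a + e) ^ c * (B₁ + B₂ + 2))) :
    AspectDecayDoubling := by
  obtain ⟨c, hD⟩ := h
  refine ⟨2 * c + 2, fun a K B ha hB => ?_⟩
  rcases Nat.eq_zero_or_pos K with rfl | hK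
  · simpa using (tropRootLawAt_zero (2 ^ (a + 1) * 0) (2 ^ lossExp (2 * c + 2) a 0 * (B + 1)))
  have hm : K ≤ 2 ^ a * K := Nat.le_mul_of_pos_left K (Nat.two_pow_pos a)
  have h1 := hD K (2 ^ a * K) (2 ^ a * K) B B hm le_rfl (Nat.le_succ _) hB hB
  have h2 : 2 ^ a * K + 2 ^ a * K = 2 ^ (a + 1) * K := by rw [pow_succ]; ring
  rw [h2] at h1
  refine tropRootLawAt_mono ?_ h1
  -- `(2^(a+1) K)^c (2B+2) ≤ 2^lossExp · (B+1)`
  have ha' : a ≤ Nat.sqrt K := Nat.le_sqrt'.mpr ha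
  have hKlt : K < 2 ^ (Nat.log 2 K + 1) := Nat.lt_pow_succ_log_self one_lt_two K
  have h3 : 2 ^ (a + 1) * K ≤ 2 ^ (a + 1 + (Nat.log 2 K + 1)) := by
    rw [pow_add 2 (a + 1)]; exact Nat.mul_le_mul_left _ hKlt.le
  have h4 : (2 ^ (a + 1) * K) ^ c * 2 ≤ 2 ^ (c * (a + Nat.log 2 K + 2) + 1) := by
    calc (2 ^ (a + 1) * K) ^ c * 2 ≤ (2 ^ (a + 1 + (Nat.log 2 K + 1))) ^ c * 2 :=
          Nat.mul_le_mul_right 2 (Nat.pow_le_pow_left h3 c)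
      _ = 2 ^ (c * (a + Nat.log 2 K + 2) + 1) := by rw [← pow_mul, pow_succ]; ring_nf
  have h5 : c * (a + Nat.log 2 K + 2) + 1 ≤ lossExp (2 * c + 2) a K := by
    unfold lossExp
    have hq : 0 ≤ K / 2 ^ a := Nat.zero_le _
    have : a + Nat.log 2 K + 2 ≤ K / 2 ^ a + Nat.sqrt K + Nat.log 2 K + 1 + 1 := by
      have := Nat.add_le_add hq ha'; omega
    nlinarith
  calc (2 ^ (a + 1) * K) ^ c * (B + B + 2) = (2 ^ (a + 1) * K) ^ c * 2 * (B + 1) := by ring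
    _ ≤ 2 ^ (c * (a + Nat.log 2 K + 2) + 1) * (B + 1) := Nat.mul_le_mul_right _ h4
    _ ≤ 2 ^ lossExp (2 * c + 2) a K * (B + 1) := Nat.mul_le_mul_right _ (Nat.pow_le_pow_right two_pos h5)

/-! ## 7. (rev 2 — critic verdict #10, prices P2–P4) the c-EXPLICIT engine, the committed instrument instance `c = 2`,
and the LOCATION of the rung

REGISTRATION TEXT (P4, verbatim for the desk): «`stub_aspectDecayDoubling` — SUFFICIENT LAW for `TropicalB` (engine ⟹ TB proved:
`TropicalB_of`), census-inert by construction (∃c; fat dyadic formats only), a dominated-risk REPLACEMENT of the registered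
`stub_signedDoubling` of `Lines/doubling.lean` (verbatim weaker hypothesis: `aspectDecayDoubling_of_signedDoubling`; the `(27/16)^K`
fat-corner risk of doubling is inside this law's allowance); composes BY NAME; LAW tier, 0 provers until a one-step mechanism is named;
`stub_boundedAspectRate` — COROLLARY RECORD (wuc negation target; proved consequence of TB, of the engine and of TowerLog; not used in
`TropicalB_of`; not finitely killable), 0 seats.  VP ≠ VNP / `MatrixDescartes` / `WeakLifting` / `OctaveWeakLifting` untouched.»

LOCATED RUNG (P2).  Write `rate_A := limsup_K log₂ T(A·K, K) / K` (bits of signed tropical capacity per slope class at aspect `A`).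
KNOWN CEILINGS: slope counting (`T+1 ≤ C(AK+K−1, K−1)`, count vectors) gives `rate_A ≤ (A+1)·H(1/(A+1)) = log₂(A+1) + A·log₂(1+1/A)
< log₂(e(A+1))`: `rate_1 ≤ 2`, `rate_2 ≤ 2.76`, `rate_4 ≤ 3.61`, `rate_8 ≤ 4.53`, `rate_A ≤ log₂A + 1.45`; in the tree:
`DoublingQuasi.tropRootLawAt_fatCone` (`rate_A ≤ 5` for `A ≤ 4`, kernel) and the separated-lex sector at the aspect-free rate `log₂ 5`.
The ratio of consecutive counting ceilings along the dyadic aspects is `(27/16)^K` (`A: 1 → 2`, `0.755` bits/class), `1.81^K`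
(`2 → 4`, `0.85`), `1.89^K` (`4 → 8`, `0.92`), tending to `2^K` (one bit per class per aspect doubling) — this is what a COUNTING-TIGHT
family would gain per doubling, and `TropicalB` (rate `≤ C` for all `A`) says tightness must die by aspect `≈ 2^C/e`.  KNOWN FLOORS:
NONE EXPONENTIAL — every recorded family with `2^(Ω(K))` alternations is thin (kernel/odometer staircases need `m ≥ 2^(Ω(K))`;
HY21-type `n^(Θ(log n))` parametric families sit at `K ≍ m²`, rate `0`); block sums and products of census champions are additive /
polynomial.  So today `0 ≤ rate_A ≤ log₂(e(A+1))` for every bounded `A`, and the FIRST bit of the rung's negation is itself open: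
«exhibit ANY bounded-aspect family with `rate_A > 0`».  A refuter of `BoundedAspectRate` must produce `rate_A → ∞`; a refuter of the
committed engine below must produce a fat dyadic level gaining more than `2·(⌊K/2^a⌋+⌊√K⌋+⌊log₂K⌋+1)` bits in one row doubling.

INSTRUMENT (P3).  As filed (`∃ c`) no census row can falsify the engine; located-A = families only — SAID.  The committed instance
for the instrument rows is `c = 2` (`stub_aspectDecayDoublingAt_two`); its predicted inequalities on the rows the cell's exact solver
can reach (`exp/tropmax_lib.solve`; `lossExp 2 a K` evaluated by `norm_num` below):
  `K = 3`: `a = 0`: `T(6,3)  + 1 ≤ 2^12 · (T(3,3) + 1)`;   `a = 1`: `T(12,3) + 1 ≤ 2^8  · (T(6,3)  + 1)`;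
  `K = 4`: `a = 0`: `T(8,4)  + 1 ≤ 2^18 · (T(4,4) + 1)`;   `a = 1`: `T(16,4) + 1 ≤ 2^14 · (T(8,4)  + 1)`;   `a = 2`: `T(32,4) + 1 ≤ 2^12 · (T(16,4) + 1)`
— every one VACUOUS against slope counting (`T(12,3) < 2·C(14,2) = 182`, `T(32,4) < 2·C(35,3) = 13090 < 2^12·(T(16,4)+1)` since
`T(16,4) ≥ 3`), so the instrument CALIBRATES (records the actual one-doubling growth factors, `≈ 3–4` on the recorded `(m,4)` rows) and
cannot kill; the smallest committed constant the census could ever bite is `c = 1` at `(32,4)` vs `(16,4)` (needs `T(16,4) ≤ 101`). -/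

/-- the engine at ONE committed constant `c` (P3). -/
def AspectDecayDoublingAt (c : ℕ) : Prop :=
  ∀ a K B : ℕ, a ^ 2 ≤ K → TropRootLawAt (2 ^ a * K) K B → TropRootLawAt (2 ^ (a + 1) * K) K (2 ^ lossExp c a K * (B + 1))

theorem aspectDecayDoubling_of_at {c : ℕ} (h : AspectDecayDoublingAt c) : AspectDecayDoubling := ⟨c, h⟩

/-- c-explicit fat rate: `AspectDecayDoublingAt c` puts every fat dyadic format at rate `7c + 6`. -/
theorem fat_dyadic_rate_of_at {c K i : ℕ} (h : AspectDecayDoublingAt c) (hi : i ^ 2 ≤ K) :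
    TropRootLawAt (2 ^ i * K) K (2 ^ ((7 * c + 6) * K)) :=
  fat_dyadic_rate h hi

theorem TropicalB_of_at {c : ℕ} (h : AspectDecayDoublingAt c) : TropicalB := TropicalB_of ⟨c, h⟩

/-- INSTRUMENT SUB-STUB (P3): the committed instance `c = 2` (fat dyadic rate `20`).  `sorry`, NOT claimed; it implies the registered
engine (`aspectDecayDoubling_of_at`).  Why it might fail before the `∃ c` engine does: counting-tightness surviving past aspect `≈ 4`
for large `K` (gain `> K + 2√K` bits at level `a = 1`, or `> K/2 + 2√K + 2log₂K + 2` at `a = 2`). -/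
theorem stub_aspectDecayDoublingAt_two : AspectDecayDoublingAt 2 := by
  sorry

/-- the predicted exponents of the instrument table (P3), checked by `norm_num`. -/
example : lossExp 2 0 3 = 12 ∧ lossExp 2 1 3 = 8 ∧ lossExp 2 0 4 = 18 ∧ lossExp 2 1 4 = 14 ∧ lossExp 2 2 4 = 12 := by norm_num [lossExp]

end Summit.ValiantsHypothesis.ValiantsHypothesis.Cruxes.TropicalB.AspectDecay
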